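import Literature.NumberTheory.LFunctions.DirichletLSeriesDeriv
import Literature.NumberTheory.LFunctions.DirichletLFunctionPolyaVinogradovBound
import Mathlib.Analysis.SumIntegralComparisons
import HarnessLib

/-!
# An explicit bound for `L'(σ, χ)` on `0 < σ ≤ 1` at Pólya–Vinogradov strength:
# `‖L'(σ, χ)‖ ≤ N^{1−σ} (½ log²N + c log N + c + (c + log N)/σ + 1/σ²)`, `N = ⌈√q (1 + log q)⌉`

Topic `Literature/NumberTheory/LFunctions` (continuing `DirichletLSeriesDeriv.lean`,
`DirichletLFunctionPolyaVinogradovBound.lean`). Everything in this file is PROVED (theorems only;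
no definition, no named fact).

For a primitive Dirichlet character `χ` mod `q ≥ 2` the tree expresses `L'(s, χ)` on `Re s > 0` as
the Abel series `∑_n S(n+1) d/ds((n+1)^{-s} − (n+2)^{-s})` (`deriv_LFunction_eq_tsum`), with the
termwise bound `‖·‖ ≤ ‖S(n+1)‖ (1 + ‖s‖ log(n+2)) (n+1)^{−Re s − 1}` (`norm_deriv_term_le`), and the
partial sums satisfy `|S(k)| ≤ k` and `|S(k)| ≤ B := √q (1 + log q)` (Pólya–Vinogradov,
`norm_partialSum_le_polyaVinogradov`). Splitting the series at `N = ⌈B⌉` (trivial bound below `N`,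
Pólya–Vinogradov above) and comparing the two resulting sums with integrals
(`∑_{k ≤ N} (c + log k)/k ≤ c + c log N + ½ log²N`, `∑_{k > N} (c + log k) k^{−1−σ} ≤
N^{−σ}((c + log N)/σ + 1/σ²)`, `c = 1 + log 2`) gives, for real `0 < σ ≤ 1`,

* `norm_deriv_LFunction_ofReal_le` — **`‖L'(σ, χ)‖ ≤ N^{1−σ}·(½ log²N + c log N + c + (c + log N)/σ
  + 1/σ²)`**, `N = ⌈√q (1 + log q)⌉`, `c = 1 + log 2`;
* `norm_deriv_LFunction_le_near_one` — for `r < 1` and `σ ∈ [1 − r, 1]` the same with `N^{r}`,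
  `1/(1 − r)`, `1/(1 − r)²` in place of `N^{1−σ}`, `1/σ`, `1/σ²`.

So `‖L'(σ, χ)‖ ≤ (⅛ + o(1)) log² q` uniformly for `1 − σ ≪ 1/log q` — the classical order with the
Pólya–Vinogradov constant; numerically `≤ (log q)²` on `[1 − 1/(40 log q), 1]` for `q ≥ 232` and
`≤ 0.46 (log q)²` for `q ≥ 10⁶` (proved in `RealZeroEffectiveRepulsionExplicitII.lean`, where, via
the mean value theorem on `[β, 1]`, it replaces the constant `55` of
`RealZeroRepulsion.norm_LFunction_one_le_mul_log_sq`). The method is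
Montgomery–Vaughan's Exercise 11.2.3 (b) ("`∑_{n ≤ y} χ(n) log n/n = −L'(1, χ) + O(q^{1/2} y^{-1}
(log qy)²)`") run at `σ < 1`.

LABEL: instrument (kernel-certified explicit constant). WHAT THIS IS NOT: not the hybrid bound in `t`
(only real `σ` is treated), not Burgess strength.

## References

* H. L. Montgomery, R. C. Vaughan, *Multiplicative Number Theory I*, CUP 2007, §4.3 Thm. 4.8, §9.4
  Thm. 9.18, §11.2.1 Exercise 3 (b). [MontgomeryVaughan2007]
-/

noncomputable section

open Complex Filter Topology Finset Set

namespace Literature.NumberTheory.LFunctions.DirichletAbel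

/-! ### Two real-variable sums compared with integrals -/

/-- Antitonicity of `x ↦ (c + log x)/x` on `[1, ∞)` for `c ≥ 1`: for `1 ≤ x ≤ y`,
`(c + log y)/y ≤ (c + log x)/x` (from `log(y/x) ≤ y/x − 1`). [folklore] -/
private theorem const_add_log_div_antitoneOn {c : ℝ} (hc : 1 ≤ c) :
    AntitoneOn (fun x : ℝ => (c + Real.log x) / x) (Ici 1) := by
  intro x hx y hy hxy
  simp only [Set.mem_Ici] at hx hy
  have hx0 : 0 < x := by linarith
  have hy0 : 0 < y := by linarith
  show (c + Real.log y) / y ≤ (c + Real.log x) / x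
  rw [div_le_div_iff₀ hy0 hx0]
  -- `x (c + log y) ≤ y (c + log x)`: `log y − log x = log(y/x) ≤ y/x − 1`, `log x ≥ 0`
  have hlog : Real.log y - Real.log x ≤ y / x - 1 := by
    rw [← Real.log_div hy0.ne' hx0.ne']
    exact Real.log_le_sub_one_of_pos (div_pos hy0 hx0)
  have hlx : 0 ≤ Real.log x := Real.log_nonneg hx
  have h1 : x * (Real.log y - Real.log x) ≤ y - x := by
    have := mul_le_mul_of_nonneg_left hlog hx0.le
    have e : x * (y / x - 1) = y - x := by field_simp
    linarith
  nlinarith [mul_nonneg (sub_nonneg.2 hxy) hlx]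

/-- `∑_{k=1}^{N} (c + log k)/k ≤ c + c log N + (log N)²/2` for `c ≥ 1`, `N ≥ 1` (the term `k = 1` is
`c`; the others are compared with `∫_1^N (c + log x)/x dx = c log N + ½ log² N`). Written over
`k = n + 1`, `n < N`. [cite: MontgomeryVaughan2007, §11.2.1 Exercise 3 (b)] [folklore] -/
theorem sum_const_add_log_div_le {c : ℝ} (hc : 1 ≤ c) {N : ℕ} (hN : 1 ≤ N) :
    ∑ n ∈ range N, (c + Real.log ((n : ℝ) + 1)) / ((n : ℝ) + 1) ≤
      c + c * Real.log N + Real.log N ^ 2 / 2 := by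
  set f : ℝ → ℝ := fun x => (c + Real.log x) / x with hf
  obtain ⟨M, rfl⟩ : ∃ M, N = M + 1 := ⟨N - 1, by omega⟩
  -- split off `n = 0`
  rw [sum_range_succ']
  simp only [Nat.cast_add, Nat.cast_one, Nat.cast_zero, zero_add, Real.log_one, add_zero, div_one]
  -- the remaining sum is `∑_{i ∈ Ico 1 (M+1)} f (i+1)`
  have hsum : ∑ n ∈ range M, (c + Real.log ((n : ℝ) + 1 + 1)) / ((n : ℝ) + 1 + 1) =
      ∑ i ∈ Ico 1 (M + 1), f ((i + 1 : ℕ) : ℝ) := by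
    rw [Finset.sum_Ico_eq_sum_range]
    simp only [add_tsub_cancel_right, hf]
    refine sum_congr rfl fun n _ => ?_
    push_cast; ring_nf
  rw [hsum]
  have hanti : AntitoneOn f (Icc ((1 : ℕ) : ℝ) ((M + 1 : ℕ) : ℝ)) :=
    (const_add_log_div_antitoneOn hc).mono fun x hx => by
      simp only [Set.mem_Icc, Nat.cast_one] at hx; exact Set.mem_Ici.2 hx.1
  have hle := AntitoneOn.sum_le_integral_Ico (f := f) (a := 1) (b := M + 1) (by omega) hanti
  -- evaluate the integral
  have hint : ∫ x in ((1 : ℕ) : ℝ)..((M + 1 : ℕ) : ℝ), f x =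
      c * Real.log ((M + 1 : ℕ) : ℝ) + Real.log ((M + 1 : ℕ) : ℝ) ^ 2 / 2 := by
    have hderiv : ∀ x ∈ uIcc ((1 : ℕ) : ℝ) ((M + 1 : ℕ) : ℝ),
        HasDerivAt (fun x : ℝ => c * Real.log x + Real.log x ^ 2 / 2) (f x) x := by
      intro x hx
      rw [Set.uIcc_of_le (by exact_mod_cast (show 1 ≤ M + 1 by omega)), Set.mem_Icc, Nat.cast_one] at hx
      have hx0 : x ≠ 0 := by linarith [hx.1]
      have h1 := (Real.hasDerivAt_log hx0).const_mul c
      have h2 := ((Real.hasDerivAt_log hx0).pow 2).div_const 2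
      refine (h1.add h2).congr_deriv ?_
      show _ = (c + Real.log x) / x
      norm_num
      field_simp
    have hcont : ContinuousOn f (uIcc ((1 : ℕ) : ℝ) ((M + 1 : ℕ) : ℝ)) := by
      rw [Set.uIcc_of_le (by exact_mod_cast (show 1 ≤ M + 1 by omega))]
      refine ContinuousOn.div (continuousOn_const.add (Real.continuousOn_log.mono ?_))
        continuousOn_id ?_
      · intro x hx; simp only [Set.mem_Icc, Nat.cast_one] at hx; exact ne_of_gt (by linarith [hx.1])
      · intro x hx; simp only [Set.mem_Icc, Nat.cast_one] at hx; exact ne_of_gt (by linarith [hx.1])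
    rw [intervalIntegral.integral_eq_sub_of_hasDerivAt hderiv (hcont.intervalIntegrable)]
    simp
  rw [hint] at hle
  push_cast at hle ⊢
  linarith

/-- Antitonicity of `x ↦ (c + log x) x^{−(σ+1)}` on `[1, ∞)` for `c ≥ 1`, `σ ≥ 0`: for
`1 ≤ x ≤ y`, `c + log y ≤ (c + log x)(1 + log(y/x)) ≤ (c + log x)(y/x) ≤ (c + log x)(y/x)^{σ+1}`.
[folklore] -/
private theorem const_add_log_mul_rpow_antitoneOn {c : ℝ} (hc : 1 ≤ c) {σ : ℝ} (hσ : 0 ≤ σ) :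
    AntitoneOn (fun x : ℝ => (c + Real.log x) * x ^ (-(σ + 1))) (Ici 1) := by
  intro x hx y hy hxy
  simp only [Set.mem_Ici] at hx hy
  have hx0 : 0 < x := by linarith
  have hy0 : 0 < y := by linarith
  show (c + Real.log y) * y ^ (-(σ + 1)) ≤ (c + Real.log x) * x ^ (-(σ + 1))
  have hlx : 0 ≤ Real.log x := Real.log_nonneg hx
  have hly : 0 ≤ Real.log y := Real.log_nonneg hy
  -- `c + log y ≤ (c + log x) · (y/x)`
  have hyx : 1 ≤ y / x := by rw [le_div_iff₀ hx0]; linarith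
  have hlog : Real.log y - Real.log x ≤ y / x - 1 := by
    rw [← Real.log_div hy0.ne' hx0.ne']
    exact Real.log_le_sub_one_of_pos (div_pos hy0 hx0)
  have h1 : c + Real.log y ≤ (c + Real.log x) * (y / x) := by
    -- `c + log y = (c + log x) + (log y − log x) ≤ (c + log x) + (c + log x)(y/x − 1)`
    have h2 : Real.log y - Real.log x ≤ (c + Real.log x) * (y / x - 1) := by
      have h3 : (1 : ℝ) * (y / x - 1) ≤ (c + Real.log x) * (y / x - 1) :=
        mul_le_mul_of_nonneg_right (by linarith) (by linarith)
      linarith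
    nlinarith
  -- `(y/x) ≤ (y/x)^{σ+1}` and `x^{-(σ+1)} = (y/x)^{σ+1} · y^{-(σ+1)}`
  have h4 : y / x ≤ (y / x) ^ (σ + 1) := by
    conv_lhs => rw [← Real.rpow_one (y / x)]
    exact Real.rpow_le_rpow_of_exponent_le hyx (by linarith)
  have hpowy : 0 < y ^ (-(σ + 1)) := Real.rpow_pos_of_pos hy0 _
  have hkey : (y / x) ^ (σ + 1) * y ^ (-(σ + 1)) = x ^ (-(σ + 1)) := by
    rw [Real.div_rpow hy0.le hx0.le, Real.rpow_neg hy0.le, Real.rpow_neg hx0.le]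
    field_simp
  calc (c + Real.log y) * y ^ (-(σ + 1))
      ≤ (c + Real.log x) * (y / x) ^ (σ + 1) * y ^ (-(σ + 1)) := by
        apply mul_le_mul_of_nonneg_right _ hpowy.le
        exact h1.trans (mul_le_mul_of_nonneg_left h4 (by linarith))
    _ = (c + Real.log x) * x ^ (-(σ + 1)) := by rw [mul_assoc, hkey]

/-- The primitive of `(c + log x) x^{−σ−1}`: `G(x) = −x^{−σ}((c + log x)/σ + 1/σ²)` has `G' = ` the
integrand on `x > 0` (`σ ≠ 0`). [folklore] -/
private theorem hasDerivAt_tailPrimitive {c σ x : ℝ} (hσ : σ ≠ 0) (hx : 0 < x) :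
    HasDerivAt (fun x : ℝ => -(x ^ (-σ) * ((c + Real.log x) / σ + 1 / σ ^ 2)))
      ((c + Real.log x) * x ^ (-(σ + 1))) x := by
  have h1 : HasDerivAt (fun x : ℝ => x ^ (-σ)) (-σ * x ^ (-σ - 1)) x := by
    simpa using Real.hasDerivAt_rpow_const (p := -σ) (Or.inl hx.ne')
  have h2 : HasDerivAt (fun x : ℝ => (c + Real.log x) / σ + 1 / σ ^ 2) (x⁻¹ / σ) x := by
    have := ((Real.hasDerivAt_log hx.ne').const_add c).div_const σ
    simpa using this.add_const (1 / σ ^ 2)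
  have h : HasDerivAt (fun x : ℝ => -(x ^ (-σ) * ((c + Real.log x) / σ + 1 / σ ^ 2)))
      (-(-σ * x ^ (-σ - 1) * ((c + Real.log x) / σ + 1 / σ ^ 2) + x ^ (-σ) * (x⁻¹ / σ))) x :=
    (h1.mul h2).neg
  refine h.congr_deriv ?_
  have e1 : x ^ (-(σ + 1)) = x ^ (-σ - 1) := by congr 1; ring
  have e2 : x ^ (-σ - 1) = x ^ (-σ) / x := Real.rpow_sub_one hx.ne' _
  rw [e1, e2]
  field_simp
  ring

/-- `∑_{k > N} (c + log k) k^{−1−σ} ≤ N^{−σ}((c + log N)/σ + 1/σ²)` for `c ≥ 1`, `N ≥ 1`,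
`0 < σ`: partial sums are below `∫_N^{N+M} = G(N+M) − G(N) ≤ −G(N)`. Written over `k = n + N + 1`;
both the bound and the summability are recorded. [cite: MontgomeryVaughan2007, §11.2.1 Exercise 3 (b)] [folklore] -/
theorem tsum_const_add_log_mul_rpow_le {c : ℝ} (hc : 1 ≤ c) {N : ℕ} (hN : 1 ≤ N) {σ : ℝ}
    (hσ : 0 < σ) :
    Summable (fun n : ℕ => (c + Real.log ((n : ℝ) + N + 1)) * ((n : ℝ) + N + 1) ^ (-(σ + 1))) ∧
    ∑' n : ℕ, (c + Real.log ((n : ℝ) + N + 1)) * ((n : ℝ) + N + 1) ^ (-(σ + 1)) ≤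
      (N : ℝ) ^ (-σ) * ((c + Real.log N) / σ + 1 / σ ^ 2) := by
  set f : ℝ → ℝ := fun x => (c + Real.log x) * x ^ (-(σ + 1)) with hf
  set G : ℝ → ℝ := fun x => -(x ^ (-σ) * ((c + Real.log x) / σ + 1 / σ ^ 2)) with hG
  have hN0 : (0 : ℝ) < N := by exact_mod_cast hN
  have hnonneg : ∀ n : ℕ, 0 ≤ (c + Real.log ((n : ℝ) + N + 1)) * ((n : ℝ) + N + 1) ^ (-(σ + 1)) := by
    intro n
    have h0 : (1 : ℝ) ≤ (n : ℝ) + N + 1 := by linarith [n.cast_nonneg (α := ℝ)]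
    exact mul_nonneg (by linarith [Real.log_nonneg h0]) (Real.rpow_nonneg (by linarith) _)
  -- partial sums
  have hpartial : ∀ M : ℕ, ∑ n ∈ range M,
      (c + Real.log ((n : ℝ) + N + 1)) * ((n : ℝ) + N + 1) ^ (-(σ + 1)) ≤
      (N : ℝ) ^ (-σ) * ((c + Real.log N) / σ + 1 / σ ^ 2) := by
    intro M
    have hsum : ∑ n ∈ range M, (c + Real.log ((n : ℝ) + N + 1)) * ((n : ℝ) + N + 1) ^ (-(σ + 1)) =
        ∑ i ∈ Ico N (N + M), f ((i + 1 : ℕ) : ℝ) := by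
      rw [Finset.sum_Ico_eq_sum_range]
      simp only [add_tsub_cancel_left, hf]
      refine sum_congr rfl fun n _ => ?_
      push_cast; ring_nf
    rw [hsum]
    have hanti : AntitoneOn f (Icc ((N : ℕ) : ℝ) ((N + M : ℕ) : ℝ)) :=
      (const_add_log_mul_rpow_antitoneOn hc hσ.le).mono fun x hx => by
        simp only [Set.mem_Icc] at hx; exact Set.mem_Ici.2 (le_trans (by exact_mod_cast hN) hx.1)
    have hle := AntitoneOn.sum_le_integral_Ico (f := f) (a := N) (b := N + M) (by omega) hanti
    have hNM : ((N : ℕ) : ℝ) ≤ ((N + M : ℕ) : ℝ) := by exact_mod_cast (show N ≤ N + M by omega)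
    have hderiv : ∀ x ∈ uIcc ((N : ℕ) : ℝ) ((N + M : ℕ) : ℝ), HasDerivAt G (f x) x := by
      intro x hx
      rw [Set.uIcc_of_le hNM, Set.mem_Icc] at hx
      exact hasDerivAt_tailPrimitive hσ.ne' (by linarith [hx.1])
    have hcont : ContinuousOn f (uIcc ((N : ℕ) : ℝ) ((N + M : ℕ) : ℝ)) := by
      rw [Set.uIcc_of_le hNM]
      refine ContinuousOn.mul (continuousOn_const.add (Real.continuousOn_log.mono ?_)) ?_
      · intro x hx; simp only [Set.mem_Icc] at hx; exact ne_of_gt (by linarith [hx.1])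
      · exact ContinuousOn.rpow_const continuousOn_id fun x hx => Or.inl (by
          simp only [Set.mem_Icc] at hx; exact ne_of_gt (by simpa using (by linarith [hx.1] : (0:ℝ) < x)))
    rw [intervalIntegral.integral_eq_sub_of_hasDerivAt hderiv hcont.intervalIntegrable] at hle
    -- `G (N+M) ≤ 0`
    have hGle : G ((N + M : ℕ) : ℝ) ≤ 0 := by
      simp only [hG, neg_nonpos]
      have h0 : (0 : ℝ) < ((N + M : ℕ) : ℝ) := by exact_mod_cast (show 0 < N + M by omega)
      have h1 : (1 : ℝ) ≤ ((N + M : ℕ) : ℝ) := by exact_mod_cast (show 1 ≤ N + M by omega)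
      have : 0 ≤ Real.log ((N + M : ℕ) : ℝ) := Real.log_nonneg h1
      exact mul_nonneg (Real.rpow_nonneg h0.le _) (by positivity)
    have hGN : G ((N : ℕ) : ℝ) = -((N : ℝ) ^ (-σ) * ((c + Real.log N) / σ + 1 / σ ^ 2)) := rfl
    linarith
  exact ⟨summable_of_sum_range_le hnonneg hpartial, Real.tsum_le_of_sum_range_le hnonneg hpartial⟩

/-! ### The derivative bound -/

variable {q : ℕ} [NeZero q] (χ : DirichletCharacter ℂ q)

/-- `1 + log(x + 1) ≤ (1 + log 2) + log x` for `x ≥ 1` (`x + 1 ≤ 2x`). [folklore] -/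
private theorem one_add_log_add_one_le {x : ℝ} (hx : 1 ≤ x) :
    1 + Real.log (x + 1) ≤ (1 + Real.log 2) + Real.log x := by
  have h : Real.log (x + 1) ≤ Real.log (2 * x) := Real.log_le_log (by linarith) (by linarith)
  rw [Real.log_mul (by norm_num) (by linarith)] at h
  linarith

/-- **Explicit bound for `L'(σ, χ)`, `0 < σ ≤ 1`**: for `χ` primitive mod `q ≥ 2`,
`‖L'(σ, χ)‖ ≤ N^{1−σ}·(½ log²N + c log N + c + (c + log N)/σ + 1/σ²)` with `N = ⌈√q (1 + log q)⌉`
and `c = 1 + log 2` (Abel summation, `|S(k)| ≤ min(k, √q(1 + log q))`, integral comparison).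
[cite: MontgomeryVaughan2007, §11.2.1 Exercise 3 (b) and §9.4 Thm 9.18] -/
theorem norm_deriv_LFunction_ofReal_le (hq : 2 ≤ q) (hχ : χ.IsPrimitive) {σ : ℝ} (hσ0 : 0 < σ)
    (hσ1 : σ ≤ 1) :
    ‖deriv χ.LFunction σ‖ ≤
      (⌈Real.sqrt q * (1 + Real.log q)⌉₊ : ℝ) ^ (1 - σ) *
        (Real.log ⌈Real.sqrt q * (1 + Real.log q)⌉₊ ^ 2 / 2 +
          (1 + Real.log 2) * Real.log ⌈Real.sqrt q * (1 + Real.log q)⌉₊ + (1 + Real.log 2) +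
          ((1 + Real.log 2) + Real.log ⌈Real.sqrt q * (1 + Real.log q)⌉₊) / σ + 1 / σ ^ 2) := by
  set B : ℝ := Real.sqrt q * (1 + Real.log q) with hB
  set N : ℕ := ⌈B⌉₊ with hNdef
  set c : ℝ := 1 + Real.log 2 with hc
  have hq1 : (1 : ℝ) < q := by exact_mod_cast hq
  have hlogq : 0 < Real.log q := Real.log_pos hq1
  have hB0 : 0 < B := mul_pos (Real.sqrt_pos.2 (by linarith)) (by linarith)
  have hBN : B ≤ N := Nat.le_ceil B
  have hN1 : 1 ≤ N := Nat.ceil_pos.2 hB0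
  have hN1r : (1 : ℝ) ≤ N := by exact_mod_cast hN1
  have hN0r : (0 : ℝ) < N := by linarith
  have hlogN : 0 ≤ Real.log N := Real.log_nonneg hN1r
  have hc1 : 1 ≤ c := by
    have := Real.log_nonneg (show (1 : ℝ) ≤ 2 by norm_num); rw [hc]; linarith
  have hne : χ ≠ 1 := by
    rintro rfl
    rw [DirichletCharacter.isPrimitive_def, DirichletCharacter.conductor_one] at hχ
    omega
  have hs : 0 < ((σ : ℂ)).re := by simp [hσ0]
  have hnorm_s : ‖(σ : ℂ)‖ = σ := by rw [Complex.norm_real, Real.norm_of_nonneg hσ0.le]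
  -- the Abel series for `L'` and its termwise bound
  rw [deriv_LFunction_eq_tsum χ hne hs]
  set F : ℕ → ℝ := fun n => ‖deriv (term χ n) (σ : ℂ)‖ with hF
  have hterm : ∀ n : ℕ, F n ≤ ‖partialSum χ (n + 1)‖ *
      ((1 + Real.log ((n : ℝ) + 2)) * ((n : ℝ) + 1) ^ (-σ - 1)) := by
    intro n
    have h := norm_deriv_term_le χ n hs
    rw [hnorm_s, Complex.ofReal_re] at h
    refine h.trans (mul_le_mul_of_nonneg_left ?_ (norm_nonneg _))
    have hlog : 0 ≤ Real.log ((n : ℝ) + 2) := Real.log_nonneg (by linarith [n.cast_nonneg (α := ℝ)])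
    have hpow : 0 ≤ ((n : ℝ) + 1) ^ (-σ - 1) := Real.rpow_nonneg (by positivity) _
    apply mul_le_mul_of_nonneg_right _ hpow
    nlinarith
  have hFsum : Summable F := by
    refine Summable.of_nonneg_of_le (fun n => norm_nonneg _) (fun n => (hterm n).trans ?_)
      ((summable_log_mul_rpow hσ0 zero_le_one).mul_left (q : ℝ))
    rw [one_mul]
    have hlog : 0 ≤ Real.log ((n : ℝ) + 2) := Real.log_nonneg (by linarith [n.cast_nonneg (α := ℝ)])
    exact mul_le_mul_of_nonneg_right (norm_partialSum_le χ hne (n + 1)) (by positivity)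
  refine (norm_tsum_le_tsum_norm hFsum).trans ?_
  change ∑' n, F n ≤ _
  rw [← hFsum.sum_add_tsum_nat_add N]
  -- HEAD: `n < N`, trivial bound `|S(n+1)| ≤ n+1`
  have hhead : ∑ n ∈ range N, F n ≤
      (N : ℝ) ^ (1 - σ) * (c + c * Real.log N + Real.log N ^ 2 / 2) := by
    have hpt : ∀ n ∈ range N, F n ≤
        (N : ℝ) ^ (1 - σ) * ((c + Real.log ((n : ℝ) + 1)) / ((n : ℝ) + 1)) := by
      intro n hn
      rw [Finset.mem_range] at hn
      have hn1 : (1 : ℝ) ≤ (n : ℝ) + 1 := by linarith [n.cast_nonneg (α := ℝ)]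
      have hn0 : (0 : ℝ) < (n : ℝ) + 1 := by linarith
      have hnN : (n : ℝ) + 1 ≤ N := by exact_mod_cast (show n + 1 ≤ N by omega)
      refine (hterm n).trans ?_
      have hS : ‖partialSum χ (n + 1)‖ ≤ (n : ℝ) + 1 := by
        have := norm_partialSum_le_self χ (n + 1); push_cast at this; exact this
      have hlog2 : 1 + Real.log ((n : ℝ) + 2) ≤ c + Real.log ((n : ℝ) + 1) := by
        have := one_add_log_add_one_le hn1; rw [hc]; convert this using 2; ring_nf
      have hpow : 0 ≤ ((n : ℝ) + 1) ^ (-σ - 1) := Real.rpow_nonneg hn0.le _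
      have hlog0 : 0 ≤ 1 + Real.log ((n : ℝ) + 2) := by
        have := Real.log_nonneg (show (1 : ℝ) ≤ (n : ℝ) + 2 by linarith); linarith
      -- `(n+1) · (n+1)^{-σ-1} = (n+1)^{1-σ}/(n+1) ≤ N^{1-σ}/(n+1)`
      have hsplit : ((n : ℝ) + 1) * ((n : ℝ) + 1) ^ (-σ - 1) =
          ((n : ℝ) + 1) ^ (1 - σ) / ((n : ℝ) + 1) := by
        rw [eq_div_iff hn0.ne', show -σ - 1 = (1 - σ) - 1 - 1 by ring, Real.rpow_sub_one hn0.ne',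
          Real.rpow_sub_one hn0.ne']
        field_simp
      have hmono : ((n : ℝ) + 1) ^ (1 - σ) ≤ (N : ℝ) ^ (1 - σ) :=
        Real.rpow_le_rpow hn0.le hnN (by linarith)
      calc ‖partialSum χ (n + 1)‖ * ((1 + Real.log ((n : ℝ) + 2)) * ((n : ℝ) + 1) ^ (-σ - 1))
          ≤ ((n : ℝ) + 1) * ((c + Real.log ((n : ℝ) + 1)) * ((n : ℝ) + 1) ^ (-σ - 1)) := by
            apply mul_le_mul hS (mul_le_mul_of_nonneg_right hlog2 hpow) (by positivity) hn0.le
        _ = ((n : ℝ) + 1) ^ (1 - σ) / ((n : ℝ) + 1) * (c + Real.log ((n : ℝ) + 1)) := by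
            rw [← hsplit]; ring
        _ ≤ (N : ℝ) ^ (1 - σ) / ((n : ℝ) + 1) * (c + Real.log ((n : ℝ) + 1)) := by
            have : 0 ≤ c + Real.log ((n : ℝ) + 1) := by linarith [Real.log_nonneg hn1]
            apply mul_le_mul_of_nonneg_right _ this
            exact div_le_div_of_nonneg_right hmono hn0.le
        _ = (N : ℝ) ^ (1 - σ) * ((c + Real.log ((n : ℝ) + 1)) / ((n : ℝ) + 1)) := by ring
    calc ∑ n ∈ range N, F n
        ≤ ∑ n ∈ range N, (N : ℝ) ^ (1 - σ) * ((c + Real.log ((n : ℝ) + 1)) / ((n : ℝ) + 1)) :=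
          sum_le_sum hpt
      _ = (N : ℝ) ^ (1 - σ) * ∑ n ∈ range N, (c + Real.log ((n : ℝ) + 1)) / ((n : ℝ) + 1) := by
          rw [mul_sum]
      _ ≤ (N : ℝ) ^ (1 - σ) * (c + c * Real.log N + Real.log N ^ 2 / 2) :=
          mul_le_mul_of_nonneg_left (sum_const_add_log_div_le hc1 hN1) (Real.rpow_nonneg hN0r.le _)
  -- TAIL: `n ≥ N`, Pólya–Vinogradov bound `|S| ≤ B ≤ N`
  obtain ⟨hgsum, hgle⟩ := tsum_const_add_log_mul_rpow_le hc1 hN1 hσ0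
  have htail : ∑' n, F (n + N) ≤ (N : ℝ) ^ (1 - σ) * ((c + Real.log N) / σ + 1 / σ ^ 2) := by
    have hpt : ∀ n : ℕ, F (n + N) ≤
        B * ((c + Real.log ((n : ℝ) + N + 1)) * ((n : ℝ) + N + 1) ^ (-(σ + 1))) := by
      intro n
      refine (hterm (n + N)).trans ?_
      have hS : ‖partialSum χ (n + N + 1)‖ ≤ B := norm_partialSum_le_polyaVinogradov χ hq hχ _
      have hx1 : (1 : ℝ) ≤ (n : ℝ) + N + 1 := by linarith [n.cast_nonneg (α := ℝ)]
      have hlog2 : 1 + Real.log (((n + N : ℕ) : ℝ) + 2) ≤ c + Real.log ((n : ℝ) + N + 1) := by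
        have := one_add_log_add_one_le hx1; rw [hc]; convert this using 2; push_cast; ring_nf
      have hpow : 0 ≤ (((n + N : ℕ) : ℝ) + 1) ^ (-σ - 1) := Real.rpow_nonneg (by positivity) _
      have hlog0 : 0 ≤ 1 + Real.log (((n + N : ℕ) : ℝ) + 2) := by
        have := Real.log_nonneg (show (1 : ℝ) ≤ ((n + N : ℕ) : ℝ) + 2 by
          linarith [(n + N).cast_nonneg (α := ℝ)]); linarith
      have hpow' : (((n + N : ℕ) : ℝ) + 1) ^ (-σ - 1) = ((n : ℝ) + N + 1) ^ (-(σ + 1)) := by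
        push_cast; congr 1; ring
      calc ‖partialSum χ (n + N + 1)‖ *
            ((1 + Real.log (((n + N : ℕ) : ℝ) + 2)) * (((n + N : ℕ) : ℝ) + 1) ^ (-σ - 1))
          ≤ B * ((c + Real.log ((n : ℝ) + N + 1)) * (((n + N : ℕ) : ℝ) + 1) ^ (-σ - 1)) :=
            mul_le_mul hS (mul_le_mul_of_nonneg_right hlog2 hpow) (by positivity) hB0.le
        _ = B * ((c + Real.log ((n : ℝ) + N + 1)) * ((n : ℝ) + N + 1) ^ (-(σ + 1))) := by
            rw [hpow']
    have hFN : Summable fun n => F (n + N) := (summable_nat_add_iff N).2 hFsum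
    calc ∑' n, F (n + N)
        ≤ ∑' n : ℕ, B * ((c + Real.log ((n : ℝ) + N + 1)) * ((n : ℝ) + N + 1) ^ (-(σ + 1))) :=
          hFN.tsum_le_tsum hpt (hgsum.mul_left B)
      _ = B * ∑' n : ℕ, (c + Real.log ((n : ℝ) + N + 1)) * ((n : ℝ) + N + 1) ^ (-(σ + 1)) :=
          tsum_mul_left
      _ ≤ (N : ℝ) * ((N : ℝ) ^ (-σ) * ((c + Real.log N) / σ + 1 / σ ^ 2)) := by
          apply mul_le_mul hBN hgle _ hN0r.le
          exact tsum_nonneg fun n => mul_nonneg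
            (by linarith [Real.log_nonneg (show (1:ℝ) ≤ (n:ℝ) + N + 1 by
              linarith [n.cast_nonneg (α := ℝ)])])
            (Real.rpow_nonneg (by linarith [n.cast_nonneg (α := ℝ)]) _)
      _ = (N : ℝ) ^ (1 - σ) * ((c + Real.log N) / σ + 1 / σ ^ 2) := by
          rw [← mul_assoc, show (1 : ℝ) - σ = -σ + 1 by ring, Real.rpow_add_one hN0r.ne']
          ring
  -- combine
  have htot := add_le_add hhead htail
  refine htot.trans (le_of_eq ?_)
  ring

/-- **Near `σ = 1`**: for `χ` primitive mod `q ≥ 2`, `r < 1` and `1 − r ≤ σ ≤ 1`,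
`‖L'(σ, χ)‖ ≤ N^{r}·(½ log²N + c log N + c + (c + log N)/(1 − r) + 1/(1 − r)²)`, `N = ⌈√q(1 + log q)⌉`,
`c = 1 + log 2`. [cite: MontgomeryVaughan2007, §11.2.1 Exercise 3 (b) and §9.4 Thm 9.18] -/
theorem norm_deriv_LFunction_le_near_one (hq : 2 ≤ q) (hχ : χ.IsPrimitive) {r : ℝ}
    (hr1 : r < 1) {σ : ℝ} (hσr : 1 - r ≤ σ) (hσ1 : σ ≤ 1) :
    ‖deriv χ.LFunction σ‖ ≤
      (⌈Real.sqrt q * (1 + Real.log q)⌉₊ : ℝ) ^ r *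
        (Real.log ⌈Real.sqrt q * (1 + Real.log q)⌉₊ ^ 2 / 2 +
          (1 + Real.log 2) * Real.log ⌈Real.sqrt q * (1 + Real.log q)⌉₊ + (1 + Real.log 2) +
          ((1 + Real.log 2) + Real.log ⌈Real.sqrt q * (1 + Real.log q)⌉₊) / (1 - r) +
          1 / (1 - r) ^ 2) := by
  set N : ℕ := ⌈Real.sqrt q * (1 + Real.log q)⌉₊ with hNdef
  set c : ℝ := 1 + Real.log 2 with hc
  have hσ0 : 0 < σ := by linarith
  have hq1 : (1 : ℝ) < q := by exact_mod_cast hq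
  have hlogq : 0 < Real.log q := Real.log_pos hq1
  have hB0 : 0 < Real.sqrt q * (1 + Real.log q) := mul_pos (Real.sqrt_pos.2 (by linarith)) (by linarith)
  have hN1 : 1 ≤ N := Nat.ceil_pos.2 hB0
  have hN1r : (1 : ℝ) ≤ N := by exact_mod_cast hN1
  have hlogN : 0 ≤ Real.log N := Real.log_nonneg hN1r
  have hc0 : 0 ≤ c := by have := Real.log_nonneg (show (1 : ℝ) ≤ 2 by norm_num); rw [hc]; linarith
  have h := norm_deriv_LFunction_ofReal_le χ hq hχ hσ0 hσ1
  have hpow : (N : ℝ) ^ (1 - σ) ≤ (N : ℝ) ^ r := Real.rpow_le_rpow_of_exponent_le hN1r (by linarith)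
  have h1r : 0 < 1 - r := by linarith
  have hinv : 1 / σ ≤ 1 / (1 - r) := one_div_le_one_div_of_le h1r hσr
  have hinv2 : 1 / σ ^ 2 ≤ 1 / (1 - r) ^ 2 :=
    one_div_le_one_div_of_le (by positivity) (pow_le_pow_left₀ h1r.le hσr 2)
  have hdiv : (c + Real.log N) / σ ≤ (c + Real.log N) / (1 - r) := by
    rw [div_eq_mul_one_div, div_eq_mul_one_div (c + Real.log N)]
    exact mul_le_mul_of_nonneg_left hinv (by positivity)
  have hbr0 : 0 ≤ Real.log N ^ 2 / 2 + c * Real.log N + c + (c + Real.log N) / σ + 1 / σ ^ 2 := by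
    positivity
  calc ‖deriv χ.LFunction σ‖
      ≤ (N : ℝ) ^ (1 - σ) * (Real.log N ^ 2 / 2 + c * Real.log N + c + (c + Real.log N) / σ +
          1 / σ ^ 2) := h
    _ ≤ (N : ℝ) ^ r * (Real.log N ^ 2 / 2 + c * Real.log N + c + (c + Real.log N) / (1 - r) +
          1 / (1 - r) ^ 2) := by
        apply mul_le_mul hpow _ hbr0 (Real.rpow_nonneg (by linarith) _)
        linarith

end Literature.NumberTheory.LFunctions.DirichletAbel
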